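import Summits.BirchSwinnertonDyer.BirchSwinnertonDyer.Theses.ResidualThetaTransportAtTwo
import Summits.BirchSwinnertonDyer.BirchSwinnertonDyer.Theorems.ResidualThetaTransportAtTwoSignedMuVanishingAtTwoPlusFlatLayer
import Summits.BirchSwinnertonDyer.BirchSwinnertonDyer.Theorems.ResidualThetaTransportAtTwoSignedMuVanishingAtTwoPlusNeronMuChild
import Summits.BirchSwinnertonDyer.BirchSwinnertonDyer.Theorems.ResidualThetaTransportAtTwoThetaLayerLambdaCongruenceAtTwoSupNormIsometry
import Literature.NumberTheory.EllipticCurves.Sprung2017.SharpFlatPAdicLFunctionTwoProofs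
import HarnessLib

/-!
# Route `ResidualThetaTransportAtTwo`, crux Kμ⁺ `SignedMuVanishingAtTwoPlus` (stmt-BirchSwinnertonDyer-20689),
# line `birth` v3, stub `stub_flatMuZeroAtTwo`: the flat residue IN PLUS MODULAR SYMBOLS —
# `2 ∤ L♭_f` ⟺ some `[5^s/2^{n+2}]⁺_f` (`n` even) has `2`-adic norm `2`; `2 ∣ L♭_f` ⟺ all of them are `2`-integral

Cell `bsd-wall`, width seat `bsd-wall-rtt-p4-w3` (helper; THEOREMS ONLY — no `def`, no named fact, no `sorry`;
nothing about any curve is asserted; BSD is not proved by this). Sequel of `…SignedMuVanishingAtTwoPlusFlatLayer`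
(p578368: `2 ∤ L⁻ ⟺ ∃ even n, ‖θ_n(f)‖_sup = 1`).

At `p = 2` the Mazur–Tate element DOUBLES (the torsion of `ℤ₂ˣ` is `{±1}` and `[−r]⁺ = [r]⁺`):
`θ_n(f) = ∑_{s mod 2ⁿ} 2·[5^s/2^{n+2}]⁺_f (1+X)^s` (tree: `Sprung2017.mazurTateElement_two_eq`), and the sup-norm in the
`(1+X)^s`-basis is the sup-norm (sibling seat rtt-p3-w2's isometry `norm_le_supNorm_sum_C_mul_X_add_one_pow` /
`exists_supNorm_sum_C_mul_X_add_one_pow_eq`). Hence `‖θ_n(f)‖_sup = ½ · max_s |[5^s/2^{n+2}]⁺_f|₂`, and the layer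
reading of p578368 becomes a statement about the `2ⁿ` rational numbers `[5^s/2^{n+2}]⁺_f` (`Ω⁺_f`-normalised plus
modular symbols at the cusps `5^s/2^{n+2}`):

* §1 `map_mazurTateElement_two_eq`, `norm_two_mul_ratPlusSymbol_le_supNorm`, `exists_supNorm_eq_norm_two_mul_ratPlusSymbol`
  (the rational-norm transfer `norm_algebraMap_rat_padicAlgCl` is the sibling seat rtt-p4-w2's, p579652, imported).
* §2 (one cusp form with a Pollack pair at `2`, `n` even): `norm_ratPlusSymbol_le_two` — EVERY `[5^s/2^{n+2}]⁺_f`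
  has `|·|₂ ≤ 2` (at worst half-integral); `not_two_dvd_flat_of_two_le_norm_ratPlusSymbol` — ONE of them with
  `|·|₂ ≥ 2` (a genuine half-integer `2`-adically) certifies `2 ∤ L⁻`; `not_two_dvd_flat_iff_exists_norm_ratPlusSymbol_eq_two`
  — `2 ∤ L⁻ ⟺ ∃ even n, ∃ s, |[5^s/2^{n+2}]⁺_f|₂ = 2`; `two_dvd_flat_iff_forall_norm_ratPlusSymbol_le_one` —
  **`2 ∣ L⁻` (μ(L♭_f) ≥ 1) ⟺ every `[5^s/2^{n+2}]⁺_f`, `n` even, is `2`-integral**.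
* §3 (habitat⁺): `flatAtTwo_iff_exists_norm_ratPlusSymbol_eq_two` — FLAT-at-`(W,f)` ⟺ some plus symbol
  `[5^s/2^{n+2}]⁺_f` (`n` even) has `2`-adic valuation exactly `−1`; `flatAtTwo_of_two_le_norm_ratPlusSymbol` — the
  one-symbol certificate (at `n = 0`: `[1/4]⁺_f = −[0]⁺_f/2`, the landed odd-`[0]⁺_f` certificate).
Since `±5^s` runs over all odd residues mod `2^{n+2}` and `[−r]⁺ = [r]⁺`, «some `[a/2^k]⁺_f`, `a` odd, `k ≥ 2` even, is
not `2`-integral» is the same statement (not spelled here).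

References: [MazurTateTeitelbaum1986Invent] §I.8, §I.13 (p = 2: Δ = {±1}, γ = 5); [Pollack2003] Prop. 6.18;
[PollackWeston2011MT] §3.1; [Sprung2017] Cor. 4.4.
-/

set_option autoImplicit false
set_option linter.dupNamespace false

noncomputable section

open scoped Classical MatrixGroups ModularForm

open CongruenceSubgroup Polynomial WeierstrassCurve Literature.NumberTheory.EllipticCurves
  Literature.NumberTheory.EllipticCurves.ModularForms Literature.NumberTheory.EllipticCurves.Rank1Residual
  Literature.NumberTheory.IwasawaTheory Summit.BirchSwinnertonDyer.Rank1Residual.Supersingular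
  Summit.BirchSwinnertonDyer.Rank1Residual.X1
  Summit.BirchSwinnertonDyer.BirchSwinnertonDyer.Theorems.ThetaLayerLambdaCongruenceAtTwo

namespace Summit.BirchSwinnertonDyer.BirchSwinnertonDyer.Theorems.SignedMuAtTwo

/-! ## §1. `‖θ_n(f)‖_sup = max_s |2·[5^s/2^{n+2}]⁺_f|₂` -/

section Symbols

variable {N : ℕ} [NeZero N] (f : CuspForm (Gamma0 N) 2)

/-- **The doubled layer element in `ℚ̄₂[X]`**: `θ_n(f) = ∑_{s mod 2ⁿ} C(2·[5^s/2^{n+2}]⁺_f)·(X+1)^s` read along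
`ℚ → ℚ̄₂` (tree: `Sprung2017.mazurTateElement_two_eq`). [cite: MazurTateTeitelbaum1986Invent, §I.13 (p = 2: Δ = {±1}, γ = 5)] -/
theorem map_mazurTateElement_two_eq (n : ℕ) :
    (mazurTateElement f 2 n).map (algebraMap ℚ (PadicAlgCl 2)) = ∑ s : ZMod (2 ^ n),
      C (algebraMap ℚ (PadicAlgCl 2) (2 * ratPlusSymbol f
        ((((cyclotomicGenerator 2 : ZMod (2 ^ (n + 2))) ^ s.val).val : ℚ) / (2 : ℚ) ^ (n + 2)))) *
        (X + 1) ^ s.val := by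
  rw [Sprung2017.mazurTateElement_two_eq f n, Polynomial.map_sum]
  refine Finset.sum_congr rfl fun s _ ↦ ?_
  rw [Polynomial.map_mul, Polynomial.map_C, Polynomial.map_pow, Polynomial.map_add, Polynomial.map_X,
    Polynomial.map_one]

/-- **Each `|2·[5^s/2^{n+2}]⁺_f|₂ ≤ ‖θ_n(f)‖_sup`** (the `(1+X)^s`-basis is isometric to the `X^j`-basis,
`norm_le_supNorm_sum_C_mul_X_add_one_pow`). [cite: PollackWeston2011MT, §3.1] -/
theorem norm_two_mul_ratPlusSymbol_le_supNorm (n : ℕ) (s : ZMod (2 ^ n)) :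
    ‖((2 * ratPlusSymbol f ((((cyclotomicGenerator 2 : ZMod (2 ^ (n + 2))) ^ s.val).val : ℚ) /
        (2 : ℚ) ^ (n + 2)) : ℚ) : ℚ_[2])‖ ≤
      ((mazurTateElement f 2 n).map (algebraMap ℚ (PadicAlgCl 2))).supNorm := by
  haveI : NeZero (2 ^ n) := ⟨pow_ne_zero _ two_ne_zero⟩
  rw [map_mazurTateElement_two_eq, ← norm_algebraMap_rat_padicAlgCl]
  exact norm_le_supNorm_sum_C_mul_X_add_one_pow (fun t : ZMod (2 ^ n) ↦ algebraMap ℚ (PadicAlgCl 2)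
    (2 * ratPlusSymbol f ((((cyclotomicGenerator 2 : ZMod (2 ^ (n + 2))) ^ t.val).val : ℚ) /
      (2 : ℚ) ^ (n + 2)))) s

/-- **`‖θ_n(f)‖_sup = |2·[5^s/2^{n+2}]⁺_f|₂` for some `s`** (the maximum is attained,
`exists_supNorm_sum_C_mul_X_add_one_pow_eq`). [cite: PollackWeston2011MT, §3.1] -/
theorem exists_supNorm_eq_norm_two_mul_ratPlusSymbol (n : ℕ) :
    ∃ s : ZMod (2 ^ n), ((mazurTateElement f 2 n).map (algebraMap ℚ (PadicAlgCl 2))).supNorm =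
      ‖((2 * ratPlusSymbol f ((((cyclotomicGenerator 2 : ZMod (2 ^ (n + 2))) ^ s.val).val : ℚ) /
        (2 : ℚ) ^ (n + 2)) : ℚ) : ℚ_[2])‖ := by
  haveI : NeZero (2 ^ n) := ⟨pow_ne_zero _ two_ne_zero⟩
  obtain ⟨s, hs⟩ := exists_supNorm_sum_C_mul_X_add_one_pow_eq (fun t : ZMod (2 ^ n) ↦
    algebraMap ℚ (PadicAlgCl 2) (2 * ratPlusSymbol f
      ((((cyclotomicGenerator 2 : ZMod (2 ^ (n + 2))) ^ t.val).val : ℚ) / (2 : ℚ) ^ (n + 2))))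
  refine ⟨s, ?_⟩
  rw [map_mazurTateElement_two_eq, hs, norm_algebraMap_rat_padicAlgCl]

/-- `|2q|₂ = |q|₂/2` for a rational `q`. [folklore] -/
theorem norm_ratCast_two_mul (q : ℚ) : ‖((2 * q : ℚ) : ℚ_[2])‖ = (2 : ℝ)⁻¹ * ‖(q : ℚ_[2])‖ := by
  have h2 : ‖(2 : ℚ_[2])‖ = (2 : ℝ)⁻¹ := by
    have h := Padic.norm_p (p := 2)
    exact_mod_cast h
  rw [Rat.cast_mul, norm_mul, Rat.cast_ofNat, h2]

end Symbols

/-! ## §2. With a Pollack pair at `2`: `2 ∣ L⁻` ⟺ all `[5^s/2^{n+2}]⁺_f` (`n` even) are `2`-integral -/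

section Pollack

variable {N : ℕ} [NeZero N] (f : CuspForm (Gamma0 N) 2) {Lplus Lminus : IwasawaAlgebra 2}

/-- **Every `[5^s/2^{n+2}]⁺_f`, `n` even, has `|·|₂ ≤ 2`** (at worst a half-integer `2`-adically) once `f` has a
Pollack pair at `2` (`‖θ_n(f)‖_sup ≤ 2^{−μ(L⁻)} ≤ 1`). [cite: Pollack2003, Prop. 6.18] [cite: PollackWeston2011MT, §3.1] -/
theorem norm_ratPlusSymbol_le_two (hP : IsPollackPair f 2 Lplus Lminus) {n : ℕ} (hn : Even n)
    (s : ZMod (2 ^ n)) :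
    ‖((ratPlusSymbol f ((((cyclotomicGenerator 2 : ZMod (2 ^ (n + 2))) ^ s.val).val : ℚ) /
        (2 : ℚ) ^ (n + 2)) : ℚ) : ℚ_[2])‖ ≤ 2 := by
  have h := (norm_two_mul_ratPlusSymbol_le_supNorm f n s).trans
    ((ResidualThetaLayer.supNorm_mazurTateElement_two_le f hP hn).trans
      (pow_le_one₀ (by norm_num) (by norm_num)))
  rw [norm_ratCast_two_mul] at h
  linarith

/-- **ONE plus symbol `[5^s/2^{n+2}]⁺_f` (`n` even) with `|·|₂ ≥ 2` certifies `2 ∤ L⁻`.**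
[cite: Pollack2003, Prop. 6.18] [cite: PollackWeston2011MT, §3.1] -/
theorem not_two_dvd_flat_of_two_le_norm_ratPlusSymbol (hP : IsPollackPair f 2 Lplus Lminus) {n : ℕ}
    (hn : Even n) {s : ZMod (2 ^ n)}
    (hs : 2 ≤ ‖((ratPlusSymbol f ((((cyclotomicGenerator 2 : ZMod (2 ^ (n + 2))) ^ s.val).val : ℚ) /
        (2 : ℚ) ^ (n + 2)) : ℚ) : ℚ_[2])‖) :
    ¬ PowerSeries.C (2 : ℤ_[2]) ∣ Lminus := by
  have hle := ResidualThetaLayer.supNorm_mazurTateElement_two_le f hP hn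
  have hcoeff := norm_two_mul_ratPlusSymbol_le_supNorm f n s
  rw [norm_ratCast_two_mul] at hcoeff
  have h1 : (1 : ℝ) ≤ (2 : ℝ)⁻¹ ^ MuLambda.mu Lminus := by
    have : (1 : ℝ) ≤ (2 : ℝ)⁻¹ * ‖((ratPlusSymbol f ((((cyclotomicGenerator 2 : ZMod (2 ^ (n + 2))) ^
        s.val).val : ℚ) / (2 : ℚ) ^ (n + 2)) : ℚ) : ℚ_[2])‖ := by
      have h2 : (0 : ℝ) < 2⁻¹ := by norm_num
      nlinarith
    exact this.trans (hcoeff.trans hle)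
  have hμ : MuLambda.mu Lminus = 0 := by
    by_contra hne
    exact absurd h1 (not_le.mpr (pow_lt_one₀ (by norm_num) (by norm_num) hne))
  have h := (mu_eq_zero_iff_not_C_dvd (p := 2) hP.2.1).mp hμ
  simpa using h

/-- **`2 ∤ L⁻` ⟺ some `[5^s/2^{n+2}]⁺_f` (`n` even) has `|·|₂ = 2`** (`2`-adic valuation exactly `−1`).
[cite: Pollack2003, Prop. 6.18] [cite: PollackWeston2011MT, §3.1 and §4] -/
theorem not_two_dvd_flat_iff_exists_norm_ratPlusSymbol_eq_two (hP : IsPollackPair f 2 Lplus Lminus) :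
    ¬ PowerSeries.C (2 : ℤ_[2]) ∣ Lminus ↔
      ∃ n : ℕ, Even n ∧ ∃ s : ZMod (2 ^ n),
        ‖((ratPlusSymbol f ((((cyclotomicGenerator 2 : ZMod (2 ^ (n + 2))) ^ s.val).val : ℚ) /
          (2 : ℚ) ^ (n + 2)) : ℚ) : ℚ_[2])‖ = 2 := by
  constructor
  · intro h
    obtain ⟨n, hn, h1⟩ := (not_two_dvd_flat_iff_exists_supNorm_mazurTateElement_eq_one f hP).mp h
    obtain ⟨s, hs⟩ := exists_supNorm_eq_norm_two_mul_ratPlusSymbol f n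
    refine ⟨n, hn, s, ?_⟩
    rw [h1, norm_ratCast_two_mul] at hs
    linarith
  · rintro ⟨n, hn, s, hs⟩
    exact not_two_dvd_flat_of_two_le_norm_ratPlusSymbol f hP hn hs.ge

/-- **`2 ∣ L⁻` (`μ(L♭_f) ≥ 1`) ⟺ every `[5^s/2^{n+2}]⁺_f`, `n` even, is `2`-integral.**
[cite: Pollack2003, Prop. 6.18] [cite: PollackWeston2011MT, §3.1 and §4] -/
theorem two_dvd_flat_iff_forall_norm_ratPlusSymbol_le_one (hP : IsPollackPair f 2 Lplus Lminus) :
    PowerSeries.C (2 : ℤ_[2]) ∣ Lminus ↔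
      ∀ n : ℕ, Even n → ∀ s : ZMod (2 ^ n),
        ‖((ratPlusSymbol f ((((cyclotomicGenerator 2 : ZMod (2 ^ (n + 2))) ^ s.val).val : ℚ) /
          (2 : ℚ) ^ (n + 2)) : ℚ) : ℚ_[2])‖ ≤ 1 := by
  constructor
  · intro h n hn s
    by_contra hlt
    push Not at hlt
    -- a norm in `ℚ₂` above `1` and at most `2` is exactly `2`
    have hle2 := norm_ratPlusSymbol_le_two f hP hn s
    set q : ℚ := ratPlusSymbol f ((((cyclotomicGenerator 2 : ZMod (2 ^ (n + 2))) ^ s.val).val : ℚ) /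
      (2 : ℚ) ^ (n + 2)) with hq
    have hq0 : (q : ℚ_[2]) ≠ 0 := fun h0 ↦ by rw [h0, norm_zero] at hlt; exact absurd hlt (by norm_num)
    obtain ⟨k, hk⟩ : ∃ k : ℤ, ‖(q : ℚ_[2])‖ = (2 : ℝ) ^ (-k) := ⟨_, Padic.norm_eq_zpow_neg_valuation hq0⟩
    have hk1 : k ≤ -1 := by
      by_contra hk'
      push Not at hk'
      have : (2 : ℝ) ^ (-k) ≤ (2 : ℝ) ^ (0 : ℤ) := zpow_le_zpow_right₀ (by norm_num) (by omega)
      rw [zpow_zero, ← hk] at this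
      exact absurd hlt (not_lt.mpr this)
    have h2 : (2 : ℝ) ≤ ‖(q : ℚ_[2])‖ := by
      rw [hk]
      have : (2 : ℝ) ^ (1 : ℤ) ≤ (2 : ℝ) ^ (-k) := zpow_le_zpow_right₀ (by norm_num) (by omega)
      rwa [zpow_one] at this
    exact not_two_dvd_flat_of_two_le_norm_ratPlusSymbol f hP hn h2 h
  · intro h
    by_contra hnd
    obtain ⟨n, hn, s, hs⟩ := (not_two_dvd_flat_iff_exists_norm_ratPlusSymbol_eq_two f hP).mp hnd
    have := h n hn s
    rw [hs] at this
    norm_num at this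

end Pollack

/-! ## §3. The habitat⁺ -/

section Habitat

variable {W : WeierstrassCurve ℚ} [W.IsElliptic] [W.IsGloballyMinimal]

/-- **FLAT-at-`(W, f)` ⟺ some plus symbol `[5^s/2^{n+2}]⁺_f` (`n` even) has `2`-adic valuation `−1`**, for `W`
good supersingular at `2` with `a₂ = 0`, analytic rank `0`, and `f` its newform.
[cite: Sprung2017, Cor. 4.4] [cite: Pollack2003, Prop. 6.18] [cite: PollackWeston2011MT, §3.1 and §4] -/
theorem flatAtTwo_iff_exists_norm_ratPlusSymbol_eq_two [NeZero (W.conductorNorm ℤ)]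
    {f : CuspForm (Gamma0 (W.conductorNorm ℤ)) 2} (hf : IsNewformOf W f) (hss : GoodSS W 2)
    (ha : W.frobeniusTrace 2 = 0) (hr : W.analyticRank = 0) :
    (∀ Lplus Lminus : IwasawaAlgebra 2, IsPollackPair f 2 Lplus Lminus → ¬ PowerSeries.C (2 : ℤ_[2]) ∣ Lminus) ↔
      ∃ n : ℕ, Even n ∧ ∃ s : ZMod (2 ^ n),
        ‖((ratPlusSymbol f ((((cyclotomicGenerator 2 : ZMod (2 ^ (n + 2))) ^ s.val).val : ℚ) /
          (2 : ℚ) ^ (n + 2)) : ℚ) : ℚ_[2])‖ = 2 := by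
  have hL : W.entireLFunction 1 ≠ 0 :=
    (WeierstrassCurve.analyticRank_eq_zero_iff_holds (W := W) hf.hasEntireLFunction).mp hr
  obtain ⟨Ls, Lf, -, hP⟩ := exists_isPollackPair_two hf hss.1 ha hL
  rw [← not_two_dvd_flat_iff_exists_norm_ratPlusSymbol_eq_two f hP]
  exact ⟨fun h ↦ h Ls Lf hP, fun h Lp Lm hP' ↦
    (not_two_dvd_flat_iff_exists_supNorm_mazurTateElement_eq_one f hP').mpr
      ((not_two_dvd_flat_iff_exists_supNorm_mazurTateElement_eq_one f hP).mp h)⟩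

/-- **One-symbol certificate**: a plus symbol `[5^s/2^{n+2}]⁺_f` (`n` even) with `|·|₂ ≥ 2` gives FLAT-at-`(W, f)`
for every Pollack pair at `2` (at `n = 0`, `s = 0`: `[1/4]⁺_f = −[0]⁺_f/2`, the odd-`[0]⁺_f` certificate).
[cite: Pollack2003, Prop. 6.18] [cite: PollackWeston2011MT, §3.1] -/
theorem flatAtTwo_of_two_le_norm_ratPlusSymbol {N : ℕ} [NeZero N] {f : CuspForm (Gamma0 N) 2} {n : ℕ}
    (hn : Even n) {s : ZMod (2 ^ n)}
    (hs : 2 ≤ ‖((ratPlusSymbol f ((((cyclotomicGenerator 2 : ZMod (2 ^ (n + 2))) ^ s.val).val : ℚ) /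
        (2 : ℚ) ^ (n + 2)) : ℚ) : ℚ_[2])‖) :
    ∀ Lplus Lminus : IwasawaAlgebra 2, IsPollackPair f 2 Lplus Lminus → ¬ PowerSeries.C (2 : ℤ_[2]) ∣ Lminus :=
  fun _ _ hP ↦ not_two_dvd_flat_of_two_le_norm_ratPlusSymbol f hP hn hs

end Habitat

end Summit.BirchSwinnertonDyer.BirchSwinnertonDyer.Theorems.SignedMuAtTwo

end
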